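import Literature.MathematicalPhysics.StatisticalMechanics.LennardJonesClusters

/-!
# Crux `GappedShellCensus.CleanLimitExtractionR` (stmt-AtomisticToContinuum-18072), line
# `CleanLimitExtractionR_CandidateProof` — stub E `stub_cleRGoodBall`

THE COUNTING STEP of the clean-limit extraction (ball counting with the hard core): along a sequence
of `δ`-separated finite configurations whose bad particles have density `≤ θ` frequently for every
`θ > 0`, for every radius `k` frequently some particle sees only good particles within distance `k`
(the volume bound `card_le_of_separated_of_dist_le`: a `δ`-separated set in a ball of radius `k` of
`ℝ³` has at most `(2k/δ + 1)³` points).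
Ported from the checked crux workfile `Cruxes/CleanLimitExtractionR/SketchIdeator2.lean` (crux-ideate,
ideator 2; farm rc 0, H21 audit `proof-of-item closed:true`); the route's clauses (gapped-twelve,
fcc/hcp-typed shell, clean site) are written out verbatim — no definitions, no notations.
-/

noncomputable section

namespace Summit.AtomisticToContinuum.Crystallization.Theorems

open Filter Topology Set
open scoped Classical
open Literature.MathematicalPhysics.StatisticalMechanics

/-- **Stub E — THE COUNTING STEP** (ball counting with the hard core): for `δ`-separated finite
configurations `x N`, if the bad particles number at most `θN` frequently for every `θ > 0`, then
for every radius `k ≥ 0`, frequently some particle has only good particles within `k` — otherwise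
every particle lies within `k` of a bad one, and the shadows of bad particles have at most
`(2k/δ + 1)³` members each (`card_le_of_separated_of_dist_le`), so `N ≤ #bad · (2k/δ+1)³ ≤ N/2`. -/
theorem stub_cleRGoodBall {x : (N : ℕ) → (Fin N → EuclideanSpace ℝ (Fin 3))} {δ : ℝ} (hδ : 0 < δ)
    (hsep : ∀ N (i j : Fin N), i ≠ j → δ ≤ dist (x N i) (x N j))
    (good : (N : ℕ) → Fin N → Prop)
    (hRDV : ∀ θ : ℝ, 0 < θ → ∃ᶠ N in atTop, (Nat.card {i : Fin N // ¬ good N i} : ℝ) ≤ θ * N)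
    (k : ℝ) (hk : 0 ≤ k) :
    ∃ᶠ N in atTop, ∃ i : Fin N, ∀ j : Fin N, dist (x N j) (x N i) ≤ k → good N j := by
  classical
  set C : ℝ := (2 * k / δ + 1) ^ 3 with hC_def
  have hC : 0 < C := by positivity
  refine ((hRDV (1 / (2 * C)) (by positivity)).and_eventually (eventually_ge_atTop 1)).mono ?_
  rintro N ⟨hbad, hN1⟩
  by_contra hcon
  push Not at hcon
  choose f hf hfbad using hcon
  have hinj : Function.Injective (x N) := by
    intro i j hij
    by_contra hne
    have := hsep N i j hne
    rw [hij, dist_self] at this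
    linarith
  set Bad : Finset (Fin N) := Finset.univ.filter fun j : Fin N => ¬ good N j with hBad_def
  have hBadcard : (Bad.card : ℝ) = Nat.card {i : Fin N // ¬ good N i} := by
    rw [Nat.card_eq_fintype_card, Fintype.card_subtype]
  -- fibres of `f` are shadows of bad particles: at most `C` members each
  have hfib : ∀ j ∈ Bad, ((Finset.univ.filter fun i : Fin N => f i = j).card : ℝ) ≤ C := by
    intro j _
    have h := card_le_of_separated_of_dist_le
      ((Finset.univ.filter fun i : Fin N => f i = j).image (x N)) (x N j) hδ hk ?_ ?_
    · rw [Finset.card_image_of_injective _ hinj, finrank_euclideanSpace_fin] at h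
      exact h
    · intro c hc
      obtain ⟨i, hi, rfl⟩ := Finset.mem_image.1 hc
      have hij : f i = j := (Finset.mem_filter.1 hi).2
      rw [← hij, dist_comm]
      exact hf i
    · intro c hc d hd hcd
      obtain ⟨i, -, rfl⟩ := Finset.mem_image.1 hc
      obtain ⟨i', -, rfl⟩ := Finset.mem_image.1 hd
      exact hsep N i i' fun h => hcd (by rw [h])
  have hcover : (Finset.univ : Finset (Fin N)) ⊆
      Bad.biUnion fun j => Finset.univ.filter fun i : Fin N => f i = j := by
    intro i _
    rw [Finset.mem_biUnion]
    exact ⟨f i, Finset.mem_filter.2 ⟨Finset.mem_univ _, hfbad i⟩,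
      Finset.mem_filter.2 ⟨Finset.mem_univ _, rfl⟩⟩
  have h1 : (N : ℝ) ≤ Bad.card * C := by
    have h2 := Finset.card_le_card hcover
    rw [Finset.card_univ, Fintype.card_fin] at h2
    have h3 := Finset.card_biUnion_le (s := Bad)
      (t := fun j => Finset.univ.filter fun i : Fin N => f i = j)
    calc (N : ℝ) ≤ ((Bad.biUnion fun j => Finset.univ.filter fun i : Fin N => f i = j).card : ℝ) := by
          exact_mod_cast h2
      _ ≤ ((∑ j ∈ Bad, (Finset.univ.filter fun i : Fin N => f i = j).card : ℕ) : ℝ) := by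
          exact_mod_cast h3
      _ = ∑ j ∈ Bad, ((Finset.univ.filter fun i : Fin N => f i = j).card : ℝ) := by push_cast; rfl
      _ ≤ ∑ j ∈ Bad, C := Finset.sum_le_sum hfib
      _ = Bad.card * C := by rw [Finset.sum_const, nsmul_eq_mul]
  rw [← hBadcard] at hbad
  have hN : (1 : ℝ) ≤ N := by exact_mod_cast hN1
  have h4 : (Bad.card : ℝ) * C ≤ 1 / (2 * C) * N * C := by gcongr
  have h5 : 1 / (2 * C) * N * C = N / 2 := by field_simp
  linarith

end Summit.AtomisticToContinuum.Crystallization.Theorems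

end
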